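import Literature.AnabelianGeometry.AbsoluteAnabelian.AbsTopIChainsCuspidalAlgorithmExists
import HarnessLib

/-!
# [AbsTopI] Lemma 4.5 (v) as typed (FACT F-0206 `CuspidalAlgorithm.RecoversCusps`): the uniform existence
# criterion over a CLASS of data, the pair form, and the cusp-less class — proofs only

S. Mochizuki, *Topics in Absolute Anabelian Geometry I: Generalities* (2012) [AbsTopI], Lemma 4.5 (v) p. 55
(manuscript pagination, lit key `paper:url-11ac98ba15fc`): "the set of cusps of [the covering determined by
`H`] is in natural bijective correspondence with the set of conjugacy classes … of decomposition groups of cusps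
[as described in (iv)]; this correspondence is functorial in `H` and compatible with the natural actions by `Π` on
both sides.  In particular, by allowing `H` to vary, this yields a ["group-theoretic"] characterization of the
decomposition groups of cusps in `Π`" [cite: MochizukiAbsTopI2012, Lemma 4.5 (v) p.55].  abc-iut-L4-t4's
`AbsTopIChains.lean` types the OUTPUT of such a characterisation as the record `CuspidalAlgorithm` (a rule
`E ↦ A.out E`, closed outputs, `Π`-conjugation stable, TRANSPORTED along every `Δ`-compatible `Π_E ≅ Π_F`) and
the model-relative comparison as `A.RecoversCusps E C` (FACT-LIST F-0206, a parametrised schema: universal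
closure refuted, `CuspidalAlgorithm.not_forall_recoversCusps`).  abc-iut-f-060's
`CuspidalAlgorithm.exists_recoversCusps_iff` (`AbsTopIChainsCuspidalAlgorithmExists.lean`) is the existence
criterion at ONE datum `(E, C)`.

The cone consumes F-0206 for a CLASS of data through ONE algorithm: abc-iut-L5's [IUTchI] Cor. 1.2 closers
and the L5 certificate bind `(A : CuspidalAlgorithm) (hA : A.RecoversCusps D.geom.pe.extXbar C.cuspidalDataXbar)
(hA' : A.RecoversCusps D'.geom.pe.extXbar C'.cuspidalDataXbar)` (two initial Θ-data).  This PROOF-ONLY file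
(no `def`, no `instance`, no named fact; witnesses built inside the proofs) records the exact intrinsic content of
such binders and the first positive instance:

* `CuspidalAlgorithm.exists_recoversCusps_family_iff` — for ANY family `(Eᵢ, Cᵢ)ᵢ` of extensions with
  cuspidal data: ONE functorial algorithm recovering the cusps of EVERY member exists **iff** every
  `Δ`-compatible isomorphism `Π_{Eᵢ} ≅ Π_{Eⱼ}` between members (automorphisms included) carries each conjugate of
  a `D_x` (`x` a cusp of `Cᵢ`) onto a conjugate of some `D_y` (`y` a cusp of `Cⱼ`) — print's "functorial …
  by allowing `H` to vary" for the class; (⇐) is the algorithm transporting the classes of ALL members along all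
  `Δ`-compatible isomorphisms (abc-iut-f-060's single-datum construction, generalised);
* `CuspidalAlgorithm.exists_recoversCusps_pair_iff` — the PAIR form (the L5 binder triple `(A, hA, hA')` is
  inhabited iff the four transport conditions `E → E`, `E → E'`, `E' → E`, `E' → E'` hold);
* `CuspidalAlgorithm.exists_recoversCusps_forall_isEmpty` — the FIRST POSITIVE INSTANCE, uniform over a class:
  ONE algorithm (the empty one) recovers the cusps of EVERY cusp-less datum — F-0206 at every PROPER datum, in
  particular at the genuine proper surface-group models (`Δ` a pro-`Σ` completion of `S_g`, cusp-less data) of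
  [AbsTopI] Lem 4.5 (i)'s census, zero residual.

TIGHTNESS (cited, not re-derived): at the split extension `G × Δ` over a GENUINE pro-`Σ` surface group of type
`(g, r)`, `r ≥ 2`, with all cusps marked, NO algorithm recovers the cusps (abc-iut-f-060,
`CuspidalData.exists_split_surfaceGroup_model_not_recoversCusps`, `AbsTopIChainsCuspidalSplitSurfaceModel.lean`:
a transvection of `Δ` moves a cusp class) — the arithmetic input of Lemma 4.5 (iii)/(iv) (Galois weights,
[CombGC] §2) is load-bearing for positive instances with cusps.

HONEST FRAMING: theorems about the cell's typed interface over abstract data; nothing of [AbsTopI] is asserted to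
be proved for curves (no étale `π₁`); a FACT-LIST row is an assumption label, not an endorsement; no side is taken
on [IUTchIII] Cor. 3.12; typed ≠ proved.
-/

namespace Literature.AnabelianGeometry.AbsoluteAnabelian

open scoped Pointwise

universe u v

namespace FundamentalExtension

/-! ### Transport lemmas (as in abc-iut-f-060's single-datum file) -/

/-- Conjugation commutes with transport along a group isomorphism: `q·α(H)·q⁻¹ = α(α⁻¹(q)·H·α⁻¹(q)⁻¹)`.
[folklore] -/
private theorem conj_smul_map_mulEquiv' {P Q : Type u} [Group P] [Group Q] (α : P ≃* Q) (H : Subgroup P)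
    (q : Q) : MulAut.conj q • H.map α.toMonoidHom = (MulAut.conj (α.symm q) • H).map α.toMonoidHom := by
  ext y
  simp only [Subgroup.mem_smul_pointwise_iff_exists, Subgroup.mem_map, MulAut.smul_def, MulAut.conj_apply,
    MulEquiv.coe_toMonoidHom]
  constructor
  · rintro ⟨s, ⟨h, hh, rfl⟩, rfl⟩
    exact ⟨α.symm q * h * (α.symm q)⁻¹, ⟨h, hh, rfl⟩, by simp⟩
  · rintro ⟨s, ⟨h, hh, rfl⟩, rfl⟩
    exact ⟨α h, ⟨h, hh, rfl⟩, by simp⟩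

/-- A `Π`-conjugate of a closed subgroup of a topological group is closed. [folklore] -/
private theorem isClosed_conj_smul'' {P : Type u} [Group P] [TopologicalSpace P] [IsTopologicalGroup P]
    {D : Subgroup P} (hD : IsClosed (D : Set P)) (g : P) :
    IsClosed ((MulAut.conj g • D : Subgroup P) : Set P) := by
  have h : ((MulAut.conj g • D : Subgroup P) : Set P) = (fun x : P => g⁻¹ * x * g) ⁻¹' (D : Set P) := by
    ext x
    rw [SetLike.mem_coe, Subgroup.mem_pointwise_smul_iff_inv_smul_mem, Set.mem_preimage, SetLike.mem_coe,
      MulAut.smul_def, MulAut.conj_inv_apply]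
  rw [h]
  exact hD.preimage (by fun_prop)

/-- Transport of a subgroup along a composite isomorphism. [folklore] -/
private theorem map_trans_eq' {E F F' : FundamentalExtension.{u}} (α : E.arith ≃ₜ* F.arith)
    (β : F.arith ≃ₜ* F'.arith) (H : Subgroup E.arith) :
    H.map (α.trans β).toMulEquiv.toMonoidHom =
      (H.map α.toMulEquiv.toMonoidHom).map β.toMulEquiv.toMonoidHom := by
  rw [Subgroup.map_map]
  rfl

/-- Transport along `β ≫ β⁻¹` is the identity on subgroups. [folklore] -/
private theorem map_trans_symm_self' {F F' : FundamentalExtension.{u}} (β : F.arith ≃ₜ* F'.arith)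
    (H : Subgroup F.arith) : H.map (β.trans β.symm).toMulEquiv.toMonoidHom = H := by
  have : (β.trans β.symm).toMulEquiv.toMonoidHom = MonoidHom.id _ :=
    MonoidHom.ext fun x => β.symm_apply_apply x
  rw [this, Subgroup.map_id]

/-! ### The uniform existence criterion over a family of data -/

/-- **UNIFORM EXISTENCE CRITERION for [AbsTopI] Lemma 4.5 (v) as typed, over a CLASS of data** ("this
correspondence is functorial … by allowing `H` to vary, this yields a group-theoretic characterization"): for a
family `(Eᵢ, Cᵢ)ᵢ` of extensions of profinite groups with cuspidal data, there is ONE functorial cuspidal algorithm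
`A` with `A.RecoversCusps (Eᵢ) (Cᵢ)` for EVERY `i` **iff** for all `i, j` every isomorphism of topological groups
`α : Π_{Eᵢ} ⥲ Π_{Eⱼ}` carrying `Δ_{Eᵢ}` onto `Δ_{Eⱼ}` carries every conjugate of a cuspidal decomposition group of
`Cᵢ` onto a conjugate of a cuspidal decomposition group of `Cⱼ`.  (⇒): transport axiom at `Eᵢ → Eⱼ`; (⇐): the
algorithm `F ↦ {α(g·D_x·g⁻¹) : i, α : Π_{Eᵢ} ⥲ Π_F Δ-compatible, x ∈ Cusp(Cᵢ), g ∈ Π_{Eᵢ}}`.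
[cite: MochizukiAbsTopI2012, Lemma 4.5 (v) p.55] -/
theorem CuspidalAlgorithm.exists_recoversCusps_family_iff {ι : Type v} (E : ι → FundamentalExtension.{u})
    (C : ∀ i, CuspidalData (E i)) :
    (∃ A : CuspidalAlgorithm.{u}, ∀ i, A.RecoversCusps (E i) (C i)) ↔
      ∀ (i j : ι) (α : (E i).arith ≃ₜ* (E j).arith),
        (E i).geom.map α.toMulEquiv.toMonoidHom = (E j).geom →
        ∀ (x : (C i).Cusp) (g : (E i).arith), ∃ (y : (C j).Cusp) (h : (E j).arith),
          (MulAut.conj g • (C i).Dcusp x).map α.toMulEquiv.toMonoidHom = MulAut.conj h • (C j).Dcusp y := by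
  constructor
  · rintro ⟨A, hA⟩ i j α hα x g
    have hi : A.out (E i) = ⋃ y : (C i).Cusp, (C i).decompositionClass y := hA i
    have hj : A.out (E j) = ⋃ y : (C j).Cusp, (C j).decompositionClass y := hA j
    have hx : MulAut.conj g • (C i).Dcusp x ∈ A.out (E i) := by
      rw [hi]
      exact Set.mem_iUnion.mpr ⟨x, g, rfl⟩
    have hx' : (MulAut.conj g • (C i).Dcusp x).map α.toMulEquiv.toMonoidHom ∈ A.out (E j) := by
      rw [A.transport (E i) (E j) α hα]
      exact Set.mem_image_of_mem _ hx
    rw [hj] at hx'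
    obtain ⟨y, hy⟩ := Set.mem_iUnion.mp hx'
    obtain ⟨h, hh⟩ := hy
    exact ⟨y, h, hh⟩
  · intro hchar
    -- the algorithm transported from ALL members of the family
    let out : ∀ F : FundamentalExtension.{u}, Set (Subgroup F.arith) := fun F =>
      {D' | ∃ (i : ι) (α : (E i).arith ≃ₜ* F.arith), (E i).geom.map α.toMulEquiv.toMonoidHom = F.geom ∧
        ∃ (x : (C i).Cusp) (g : (E i).arith),
          D' = (MulAut.conj g • (C i).Dcusp x).map α.toMulEquiv.toMonoidHom}
    refine ⟨{ out := out, isClosed_of_mem := ?_, conj_mem := ?_, transport := ?_ }, fun j => ?_⟩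
    · -- outputs are closed: a homeomorphic image of a conjugate of a closed `D_x`
      rintro F D' ⟨i, α, -, x, g, rfl⟩
      rw [Subgroup.coe_map]
      exact α.toHomeomorph.isClosedMap _ (isClosed_conj_smul'' ((C i).isClosed_Dcusp x) g)
    · -- outputs are conjugation-stable
      rintro F D' g' ⟨i, α, hα, x, g, rfl⟩
      refine ⟨i, α, hα, x, α.toMulEquiv.symm g' * g, ?_⟩
      rw [conj_smul_map_mulEquiv', map_mul, mul_smul]
    · -- functorial transport along `β : Π_F ≅ Π_{F'}`
      intro F F' β hβ
      ext D''
      constructor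
      · rintro ⟨i, α', hα', x, g, rfl⟩
        refine ⟨(MulAut.conj g • (C i).Dcusp x).map (α'.trans β.symm).toMulEquiv.toMonoidHom,
          ⟨i, α'.trans β.symm, ?_, x, g, rfl⟩, ?_⟩
        · refine geom_map_trans α' β.symm hα' ?_
          rw [← hβ, ← map_trans_eq', map_trans_symm_self']
        · change ((MulAut.conj g • (C i).Dcusp x).map (α'.trans β.symm).toMulEquiv.toMonoidHom).map
              β.toMulEquiv.toMonoidHom = _
          rw [← map_trans_eq']
          exact congrArg (fun φ => (MulAut.conj g • (C i).Dcusp x).map φ)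
            (MonoidHom.ext fun z => β.apply_symm_apply (α' z))
      · rintro ⟨D', ⟨i, α, hα, x, g, rfl⟩, rfl⟩
        exact ⟨i, α.trans β, geom_map_trans α β hα hβ, x, g, (map_trans_eq' α β _).symm⟩
    · -- the output on `E j` is the set of decomposition groups of cusps of `C j`
      change out (E j) = ⋃ y : (C j).Cusp, (C j).decompositionClass y
      ext D'
      rw [Set.mem_iUnion]
      constructor
      · rintro ⟨i, α, hα, x, g, rfl⟩
        obtain ⟨y, h, hy⟩ := hchar i j α hα x g
        exact ⟨y, h, hy⟩
      · rintro ⟨y, g, rfl⟩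
        refine ⟨j, ContinuousMulEquiv.refl _, ?_, y, g, ?_⟩
        · exact Subgroup.map_id _
        · exact (Subgroup.map_id _).symm

/-- The family criterion with the conclusion in abc-iut-f-060's single-datum shape (representatives `D_x` only):
conjugates are absorbed since `α(g·D_x·g⁻¹) = α(g)·α(D_x)·α(g)⁻¹`. [cite: MochizukiAbsTopI2012, Lemma 4.5 (v) p.55] -/
theorem CuspidalAlgorithm.exists_recoversCusps_family_iff' {ι : Type v} (E : ι → FundamentalExtension.{u})
    (C : ∀ i, CuspidalData (E i)) :
    (∃ A : CuspidalAlgorithm.{u}, ∀ i, A.RecoversCusps (E i) (C i)) ↔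
      ∀ (i j : ι) (α : (E i).arith ≃ₜ* (E j).arith),
        (E i).geom.map α.toMulEquiv.toMonoidHom = (E j).geom →
        ∀ x : (C i).Cusp, ∃ (y : (C j).Cusp) (h : (E j).arith),
          ((C i).Dcusp x).map α.toMulEquiv.toMonoidHom = MulAut.conj h • (C j).Dcusp y := by
  rw [CuspidalAlgorithm.exists_recoversCusps_family_iff]
  constructor
  · intro hchar i j α hα x
    obtain ⟨y, h, hy⟩ := hchar i j α hα x 1
    exact ⟨y, h, by simpa using hy⟩
  · intro hchar i j α hα x g
    obtain ⟨y, h, hy⟩ := hchar i j α hα x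
    refine ⟨y, α g * h, ?_⟩
    have hg : α.toMulEquiv.symm (α g) = g := α.toMulEquiv.symm_apply_apply g
    rw [map_mul, mul_smul, ← hy, conj_smul_map_mulEquiv', hg]

/-! ### The pair form (the shape of the L5 certificate's binder triple) -/

/-- **PAIR FORM** — the intrinsic content of a binder triple `(A, hA : A.RecoversCusps E C,
hA' : A.RecoversCusps E' C')` (abc-iut-L5's [IUTchI] Cor. 1.2 closers / L5 certificate, at the two
`X̲`-extensions of two initial Θ-data): such a triple EXISTS iff every `Δ`-compatible isomorphism `Π_E ⥲ Π_E`,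
`Π_E ⥲ Π_{E'}`, `Π_{E'} ⥲ Π_E`, `Π_{E'} ⥲ Π_{E'}` carries cuspidal decomposition groups onto conjugates of cuspidal
decomposition groups ("the cusps of `X̲` and of `X̲'` are group-theoretic, compatibly").
[cite: MochizukiAbsTopI2012, Lemma 4.5 (v) p.55] -/
theorem CuspidalAlgorithm.exists_recoversCusps_pair_iff {E E' : FundamentalExtension.{u}} (C : CuspidalData E)
    (C' : CuspidalData E') :
    (∃ A : CuspidalAlgorithm.{u}, A.RecoversCusps E C ∧ A.RecoversCusps E' C') ↔
      (∀ α : E.arith ≃ₜ* E.arith, E.geom.map α.toMulEquiv.toMonoidHom = E.geom →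
        ∀ x : C.Cusp, ∃ (y : C.Cusp) (h : E.arith),
          (C.Dcusp x).map α.toMulEquiv.toMonoidHom = MulAut.conj h • C.Dcusp y) ∧
      (∀ α : E.arith ≃ₜ* E'.arith, E.geom.map α.toMulEquiv.toMonoidHom = E'.geom →
        ∀ x : C.Cusp, ∃ (y : C'.Cusp) (h : E'.arith),
          (C.Dcusp x).map α.toMulEquiv.toMonoidHom = MulAut.conj h • C'.Dcusp y) ∧
      (∀ α : E'.arith ≃ₜ* E.arith, E'.geom.map α.toMulEquiv.toMonoidHom = E.geom →
        ∀ x : C'.Cusp, ∃ (y : C.Cusp) (h : E.arith),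
          (C'.Dcusp x).map α.toMulEquiv.toMonoidHom = MulAut.conj h • C.Dcusp y) ∧
      (∀ α : E'.arith ≃ₜ* E'.arith, E'.geom.map α.toMulEquiv.toMonoidHom = E'.geom →
        ∀ x : C'.Cusp, ∃ (y : C'.Cusp) (h : E'.arith),
          (C'.Dcusp x).map α.toMulEquiv.toMonoidHom = MulAut.conj h • C'.Dcusp y) := by
  -- index the pair by `Bool`: `true ↦ (E, C)`, `false ↦ (E', C')`
  let Eb : Bool → FundamentalExtension.{u} := fun b => Bool.rec E' E b
  let Cb : ∀ b, CuspidalData (Eb b) := fun b => Bool.rec (motive := fun b => CuspidalData (Eb b)) C' C b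
  have key := CuspidalAlgorithm.exists_recoversCusps_family_iff' Eb Cb
  have hl : (∃ A : CuspidalAlgorithm.{u}, ∀ b, A.RecoversCusps (Eb b) (Cb b)) ↔
      ∃ A : CuspidalAlgorithm.{u}, A.RecoversCusps E C ∧ A.RecoversCusps E' C' := by
    constructor
    · rintro ⟨A, hA⟩
      exact ⟨A, hA true, hA false⟩
    · rintro ⟨A, hA, hA'⟩
      exact ⟨A, fun b => Bool.rec (motive := fun b => A.RecoversCusps (Eb b) (Cb b)) hA' hA b⟩
  rw [← hl, key]
  constructor
  · intro h
    exact ⟨h true true, h true false, h false true, h false false⟩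
  · rintro ⟨h₁, h₂, h₃, h₄⟩ i j
    cases i <;> cases j
    · exact h₄
    · exact h₃
    · exact h₂
    · exact h₁

/-! ### The cusp-less class: the first positive instance -/

/-- **F-0206 HOLDS UNIFORMLY on the class of cusp-less data** ([AbsTopI] Lemma 4.5 (v) for PROPER curves — no
cusps, nothing to recover): ONE functorial algorithm — the empty one, `A.out F = ∅` for every `F` (closed /
conjugation-stable / transported vacuously) — satisfies `A.RecoversCusps E C` for EVERY extension `E` and every
cuspidal data `C` without cusps; in particular at the genuine proper surface-group models (`Δ` a pro-`Σ` completion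
of the surface group `S_g`, `g ≥ 2`, cusp-less data) of the [AbsTopI] Lem 4.5 (i) census.
[cite: MochizukiAbsTopI2012, Lemma 4.5 (v) p.55] -/
theorem CuspidalAlgorithm.exists_recoversCusps_forall_isEmpty :
    ∃ A : CuspidalAlgorithm.{u}, ∀ (E : FundamentalExtension.{u}) (C : CuspidalData E),
      IsEmpty C.Cusp → A.RecoversCusps E C := by
  refine ⟨⟨fun _ => ∅, ?_, ?_, ?_⟩, fun E C hC => ?_⟩
  · intro F D h
    exact absurd h (Set.notMem_empty D)
  · intro F D g h
    exact absurd h (Set.notMem_empty D)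
  · intro F F' β hβ
    exact (Set.image_empty _).symm
  · change (∅ : Set (Subgroup E.arith)) = ⋃ x : C.Cusp, C.decompositionClass x
    rw [Set.iUnion_of_empty]

/-- The empty algorithm is the ONLY possibility on cusp-less data, and conversely an algorithm recovering the
cusps of a cusp-less datum has empty output there: `A.RecoversCusps E C` with `Cusp(C)` empty iff `A.out E = ∅`.
[cite: MochizukiAbsTopI2012, Lemma 4.5 (v) p.55] -/
theorem CuspidalAlgorithm.recoversCusps_iff_out_eq_empty_of_isEmpty (A : CuspidalAlgorithm.{u})
    (E : FundamentalExtension.{u}) (C : CuspidalData E) [IsEmpty C.Cusp] :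
    A.RecoversCusps E C ↔ A.out E = ∅ := by
  unfold CuspidalAlgorithm.RecoversCusps
  rw [Set.iUnion_of_empty]

/-- On a datum WITH a cusp, an algorithm recovering the cusps has NON-empty output (so the empty algorithm of
`exists_recoversCusps_forall_isEmpty` recovers the cusps of `(E, C)` iff `C` has no cusps).
[cite: MochizukiAbsTopI2012, Lemma 4.5 (v) p.55] -/
theorem CuspidalAlgorithm.RecoversCusps.out_nonempty {A : CuspidalAlgorithm.{u}} {E : FundamentalExtension.{u}}
    {C : CuspidalData E} (hA : A.RecoversCusps E C) [hC : Nonempty C.Cusp] : (A.out E).Nonempty := by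
  obtain ⟨x⟩ := hC
  refine ⟨C.Dcusp x, ?_⟩
  have h : A.out E = ⋃ y : C.Cusp, C.decompositionClass y := hA
  rw [h]
  exact Set.mem_iUnion.mpr ⟨x, C.Dcusp_mem_decompositionClass x⟩

end FundamentalExtension

end Literature.AnabelianGeometry.AbsoluteAnabelian
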